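import Literature.NumberTheory.Rogawski1990.FinExplicitTransferFactorGHRegular          -- ★ (P-β): `isUnit_finTauArg_of_isUnit`, `finEigenlineProjector_ne_zero_of_isUnit`; ★ `…KappaEigenvector`, ★ `…ConjRight`, ★ `LocalRegularOrbitClosed`
import HarnessLib

/-!
# On a `(G,H)`-regular matching pair the `H′_v`-value `x_j = p_jᴴ H′_v p_j` of every non-zero column `p_j` of `P_v = χ_g(γ′)` is a UNIT, and the sign
# `κ_v` of Rogawski's explicit factor reads on ANY non-zero column (Rogawski (1990) §3.5 Prop. 3.5.2 (c), §4.3, §4.9)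

Topic `NumberTheory/Rogawski1990`; namespace `Literature.NumberTheory.Rogawski1990`.  THEOREMS ONLY (no definition, no named fact, no instance, no notation,
no `sorry`; net debt 0).  Cell `pub/hodgecm-mathlib`, F0∕P3a, topic T6 (#88 side, node D-G4 of `SIZING-S1prime` §2∕§7): the ALGEBRA half of «the sign
`κ_v` of ★ `finExplicitDelta` (typ-T6b N1f) is locally constant near a `(G,H)`-regular matching pair» — consumed by the sibling
`FinExplicitTransferFactorLocallyConstant` (topology half).  Mathlib-only footing; count-neutral for the books.

THE MATHEMATICS.  `v` a finite place of `L⁺`, `E_v = L ⊗ L⁺_v = Π_{w∣v} L_w`, `σ = c ⊗ 1`, `H′_v` the local form, `P_v(γ_H, γ′) = χ_g(γ′) = γ′² − tr(g)γ′ + det g`,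
`u = γ₂` (★ `FinExplicitTransferFactor`).  On a matching pair `ι_v(γ_H) ↔ γ′` with `χ_g(u)` a unit (`γ′` may be `G`-SINGULAR — print's `γ₀ ∈ M`,
`γ_H = (e₁·1₂, e₂)`, `χ_g(e₂) = (e₂ − e₁)² ≠ 0`): for a `u`-eigenvector `p` of `γ′` the covector `r = σ(p)ᵀ H′_v` is a LEFT `u`-eigen-covector, `r γ′ = u r`
(unitarity `σ(γ′)ᵀ H′_v γ′ = H′_v` ★ `map_conjLocal_transpose_mul_localForm_mul`, `σ(u) u = 1` ★ `conjLocal_finGammaTwo_mul_finGammaTwo`), hence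
`r P_v = χ_g(u) r`; with `P_v = p′ qᵀ` (★ `finEigenlineProjector_eq_vecMulVec_of_isLocalNormPair`) also `r P_v = (r·p′) q`, and for the column `p = p_j = q_j p′`:
`x_j = r·p_j = (r·p′) q_j`.  At a NON-SPLIT `v` (`E_v` a field): `x_j = 0` with `p_j ≠ 0` forces `r·p′ = 0`, `χ_g(u) r = 0`, `r = 0`, `σ(p_j) = 0` (`det H′_v`
a unit), `p_j = 0` — so **`x_j` is a unit**: the `u`-eigenline of `γ′` is `H′_v`-anisotropic exactly because `u` is a simple eigenvalue.  (The local twin of ★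
`star_dotProduct_form_mulVec_ne_zero_of_conj_eq` at rational pairs; without it `κ_v` would not be locally constant — the unit-norm test jumps at `0`.)  Then ★
`finKappaAt_eq_ite_of_eigenvector` (which reads `κ_v` on any non-zero `u`-eigenvector) applies to every non-zero column (★
`localMatrix_mulVec_finEigenlineProjector_col`), not only to the first one read by ★ `finRelPos`.

* §1 `vecMul_localMatrix_eq_smul_of_eigenvector` (`r γ′ = u r`), `vecMul_finEigenlineProjector_eq_smul_of_eigenvector` (`r P_v = χ_g(u) r`),
  `finColumnFormValue_eq_dotProduct` (`x_j = r · p_j`), **`isUnit_finColumnFormValue_of_col_ne_zero`**.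
* §2 **`finKappaAt_eq_ite_finColumnFormValue`** — `κ_v = [x_j = z σ(z), z unit] ? 1 : −1` for every non-zero column `j` (non-split `v`).

HONEST LABEL: HC_CM is proved only modulo the printed citations (named inputs remaining 2) until rung 0 closes; this file proves none of them.

## References
* [Rogawski1990] J. D. Rogawski, *Automorphic Representations of Unitary Groups in Three Variables*, Ann. of Math. Stud. 123 (1990): §3.5 Prop. 3.5.2 (c) p. 29
  (`H¹(F, T)`, the degree-one coordinate `H′(p, p)` mod norms), §4.3 pp. 42–43 (`inv(γ, γ′)`, `κ`), §4.9 p. 55 (`Δ_{G∕H}`, `χ_g`), §14.6 p. 242 (`κ = ±1`).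
* [LanglandsShelstad1987] R. P. Langlands, D. Shelstad, *On the definition of transfer factors*, Math. Ann. 278 (1987), §1–§2.
-/

set_option autoImplicit false

noncomputable section

open NumberField IsDedekindDomain Matrix Polynomial Filter Topology
open scoped MatrixGroups

namespace Literature.NumberTheory.Rogawski1990

open Literature.NumberTheory.Automorphic
open Literature.NumberTheory.GaloisRepresentations
open Literature.NumberTheory.GelbartRogawski1991.UnitaryDualPair (imagUnit complexConj_imagUnit imagUnit_ne_zero)

/-! ## §1 The `H′_v`-value of a non-zero column of `P_v` is a unit (non-split `v`, `χ_g(u)` a unit) -/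

section ColumnUnit

variable (L : Type) [Field L] [NumberField L] [IsCMField L] (v : HeightOneSpectrum (𝓞 ↥(maximalRealSubfield L)))
  (H' : Matrix (Fin 3) (Fin 3) L)
  (a : (UnitaryGroup.cmDatum L 2 (Matrix.of fun i j : Fin 2 => if i.val + j.val + 1 = 2 then (1 : L) else 0)).Local v ×
      (UnitaryGroup.cmDatum L 1 (Matrix.of fun i j : Fin 1 => if i.val + j.val + 1 = 1 then (1 : L) else 0)).Local v)
  (b : (UnitaryGroup.cmDatum L 3 H').Local v)

/-- **`σ(p)ᵀ H′_v` is a LEFT `u`-eigen-covector of `γ′`** for every `u`-eigenvector `p` (`γ′ p = u p`): `(σ(p)ᵀ H′_v) γ′ = u · σ(p)ᵀ H′_v` — from the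
unitarity `σ(γ′)ᵀ H′_v γ′ = H′_v` of `γ′ ∈ U(H′)(L⁺_v)` and `σ(u) u = 1`. [cite: Rogawski1990, §4.3 p. 42; §4.9 p. 55] -/
theorem vecMul_localMatrix_eq_smul_of_eigenvector {p : Fin 3 → UnitaryGroup.LocalRing L v}
    (hp : (b.val.val : Matrix (Fin 3) (Fin 3) (UnitaryGroup.LocalRing L v)) *ᵥ p = finGammaTwo L v a • p) :
    ((UnitaryGroup.conjLocal L (IsCMField.complexConj L) v ∘ p) ᵥ* (UnitaryGroup.adelicForm L 3 H').map (UnitaryGroup.adeleToLocal L v)) ᵥ*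
        (b.val.val : Matrix (Fin 3) (Fin 3) (UnitaryGroup.LocalRing L v)) =
      finGammaTwo L v a •
        ((UnitaryGroup.conjLocal L (IsCMField.complexConj L) v ∘ p) ᵥ* (UnitaryGroup.adelicForm L 3 H').map (UnitaryGroup.adeleToLocal L v)) := by
  set σ := UnitaryGroup.conjLocal L (IsCMField.complexConj L) v with hσ
  set Hv := (UnitaryGroup.adelicForm L 3 H').map (UnitaryGroup.adeleToLocal L v) with hHv
  set B : Matrix (Fin 3) (Fin 3) (UnitaryGroup.LocalRing L v) := b.val.val with hB
  have hU : (B.map σ)ᵀ * Hv * B = Hv := map_conjLocal_transpose_mul_localForm_mul L v H' b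
  have huu : σ (finGammaTwo L v a) * finGammaTwo L v a = 1 := conjLocal_finGammaTwo_mul_finGammaTwo L v a
  -- `σ ∘ (B p) = (B.map σ) (σ ∘ p)`
  have hmap : (σ ∘ (B *ᵥ p)) = (B.map σ) *ᵥ (σ ∘ p) := by
    funext i
    exact RingHom.map_mulVec σ B p i
  have hσp : (σ ∘ p) ᵥ* (B.map σ)ᵀ = σ (finGammaTwo L v a) • (σ ∘ p) := by
    rw [vecMul_transpose, ← hmap, hp]
    funext i
    simp only [Function.comp_apply, Pi.smul_apply, smul_eq_mul, map_mul]
  -- `r = (σp (Bσ)ᵀ Hv) B = σ(u) • (r B)`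
  have hkey : (σ ∘ p) ᵥ* Hv = σ (finGammaTwo L v a) • (((σ ∘ p) ᵥ* Hv) ᵥ* B) := by
    conv_lhs => rw [← hU]
    rw [← vecMul_vecMul, ← vecMul_vecMul, hσp, smul_vecMul, smul_vecMul]
  calc ((σ ∘ p) ᵥ* Hv) ᵥ* B = (finGammaTwo L v a * σ (finGammaTwo L v a)) • (((σ ∘ p) ᵥ* Hv) ᵥ* B) := by
        rw [mul_comm, huu, one_smul]
    _ = finGammaTwo L v a • (σ (finGammaTwo L v a) • (((σ ∘ p) ᵥ* Hv) ᵥ* B)) := by rw [smul_smul]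
    _ = finGammaTwo L v a • ((σ ∘ p) ᵥ* Hv) := by rw [← hkey]

/-- **`σ(p)ᵀ H′_v · P_v = χ_g(u) · σ(p)ᵀ H′_v`** for a `u`-eigenvector `p` of `γ′`: `P_v = γ′² − tr(g) γ′ + det g` is a polynomial in `γ′`, and
`χ_g(u) = u² − tr(g) u + det g` (★ `eval_finCharpolyTwo_finGammaTwo`). [cite: Rogawski1990, §4.9 p. 55] -/
theorem vecMul_finEigenlineProjector_eq_smul_of_eigenvector {p : Fin 3 → UnitaryGroup.LocalRing L v}
    (hp : (b.val.val : Matrix (Fin 3) (Fin 3) (UnitaryGroup.LocalRing L v)) *ᵥ p = finGammaTwo L v a • p) :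
    ((UnitaryGroup.conjLocal L (IsCMField.complexConj L) v ∘ p) ᵥ* (UnitaryGroup.adelicForm L 3 H').map (UnitaryGroup.adeleToLocal L v)) ᵥ*
        finEigenlineProjector L v H' a b =
      ((finCharpolyTwo L v a).eval (finGammaTwo L v a)) •
        ((UnitaryGroup.conjLocal L (IsCMField.complexConj L) v ∘ p) ᵥ* (UnitaryGroup.adelicForm L 3 H').map (UnitaryGroup.adeleToLocal L v)) := by
  set r := (UnitaryGroup.conjLocal L (IsCMField.complexConj L) v ∘ p) ᵥ* (UnitaryGroup.adelicForm L 3 H').map (UnitaryGroup.adeleToLocal L v)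
    with hr
  have h1 : r ᵥ* (b.val.val : Matrix (Fin 3) (Fin 3) (UnitaryGroup.LocalRing L v)) = finGammaTwo L v a • r :=
    vecMul_localMatrix_eq_smul_of_eigenvector L v H' a b hp
  have h2 : r ᵥ* ((b.val.val : Matrix (Fin 3) (Fin 3) (UnitaryGroup.LocalRing L v)) * b.val.val) =
      (finGammaTwo L v a * finGammaTwo L v a) • r := by
    rw [← vecMul_vecMul, h1, smul_vecMul, h1, smul_smul]
  rw [eval_finCharpolyTwo_finGammaTwo]
  dsimp only [finEigenlineProjector]
  rw [vecMul_add, vecMul_sub, h2, vecMul_smul, h1, smul_smul, vecMul_smul, vecMul_one, ← sub_smul, ← add_smul]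

/-- **`x_j = (σ(p_j)ᵀ H′_v) · p_j`** for the `j`-th column `p_j` of `P_v` (★ `finColumnFormValue`, unfolded as a dot product).
[cite: Rogawski1990, §3.5 Prop. 3.5.2 (c) p. 29] -/
theorem finColumnFormValue_eq_dotProduct (γ' : (UnitaryGroup.cmDatum L 3 H').Local v) (j : Fin 3) :
    finColumnFormValue L v H' a γ' j =
      ((UnitaryGroup.conjLocal L (IsCMField.complexConj L) v ∘ fun i => finEigenlineProjector L v H' a γ' i j) ᵥ*
          (UnitaryGroup.adelicForm L 3 H').map (UnitaryGroup.adeleToLocal L v)) ⬝ᵥ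
        fun i => finEigenlineProjector L v H' a γ' i j := by
  unfold finColumnFormValue
  simp only [dotProduct, vecMul, Function.comp_apply, Finset.sum_mul]
  rw [Finset.sum_comm]

/-- **THE `H′_v`-VALUE OF A NON-ZERO COLUMN OF `P_v` IS A UNIT** at a non-split `v`, on a matching pair `ι_v(γ_H) ↔ γ′` with `χ_g(u)` a unit (`γ′` may be
`G`-singular) and `det H′ ≠ 0`: `x_j = p_jᴴ H′_v p_j ≠ 0`.  (With `P_v = p′ qᵀ`, `p_j = q_j p′`, `r = σ(p_j)ᵀ H′_v`: `r P_v = χ_g(u) r = (r·p′) q` and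
`x_j = (r·p′) q_j`; `x_j = 0 ⇒ r = 0 ⇒ p_j = 0`.)  Equivalently: the `u`-eigenline of `γ′` is `H′_v`-anisotropic — the eigenvalue `u` is simple.  Without
this the sign `κ_v` would not be locally constant (the unit-norm test jumps at `0`). [cite: Rogawski1990, §3.5 Prop. 3.5.2 (c) p. 29; §4.3 pp. 42–43; §4.9 p. 55] -/
theorem isUnit_finColumnFormValue_of_col_ne_zero (hv : Subsingleton (UnitaryGroup.PlacesOver L v)) (hdet : H'.det ≠ 0)
    (h : IsLocalNormPair L H' v a b) (hu : IsUnit ((finCharpolyTwo L v a).eval (finGammaTwo L v a))) {j : Fin 3}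
    (hj : (fun i => finEigenlineProjector L v H' a b i j) ≠ 0) :
    IsUnit (finColumnFormValue L v H' a b j) := by
  set σ := UnitaryGroup.conjLocal L (IsCMField.complexConj L) v with hσ
  set Hv := (UnitaryGroup.adelicForm L 3 H').map (UnitaryGroup.adeleToLocal L v) with hHv
  set pj : Fin 3 → UnitaryGroup.LocalRing L v := fun i => finEigenlineProjector L v H' a b i j with hpj
  set r := (σ ∘ pj) ᵥ* Hv with hr
  obtain ⟨p', q, hP⟩ := finEigenlineProjector_eq_vecMulVec_of_isLocalNormPair L v H' a b h
  have hcol : pj = fun i => p' i * q j := by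
    funext i
    rw [hpj]
    dsimp only
    rw [hP, vecMulVec_apply]
  -- `q j` is a unit
  have hqj : IsUnit (q j) := by
    refine isUnit_localRing_of_ne_zero_of_subsingleton L v hv fun hq0 => hj ?_
    rw [hcol]
    funext i
    rw [hq0, mul_zero, Pi.zero_apply]
  -- the two expressions for `r P_v`
  have hrP : r ᵥ* finEigenlineProjector L v H' a b = ((finCharpolyTwo L v a).eval (finGammaTwo L v a)) • r :=
    vecMul_finEigenlineProjector_eq_smul_of_eigenvector L v H' a b (localMatrix_mulVec_finEigenlineProjector_col L v H' a b h j)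
  have hrP' : r ᵥ* finEigenlineProjector L v H' a b = (r ⬝ᵥ p') • q := by
    rw [hP, vecMul_vecMulVec]
  -- `x_j = (r · p′) q_j`
  have hx : finColumnFormValue L v H' a b j = (r ⬝ᵥ p') * q j := by
    rw [finColumnFormValue_eq_dotProduct, ← hpj, ← hr, hcol]
    simp only [dotProduct, Finset.sum_mul, mul_assoc]
  refine isUnit_localRing_of_ne_zero_of_subsingleton L v hv fun h0 => hj ?_
  -- from `x_j = 0`: `r · p′ = 0`, `r = 0`, `σ pj = 0`, `pj = 0`
  have hrp : r ⬝ᵥ p' = 0 := by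
    rw [hx] at h0
    exact (hqj.mul_left_eq_zero).1 h0
  have hr0 : r = 0 := by
    have h1 : ((finCharpolyTwo L v a).eval (finGammaTwo L v a)) • r = 0 := by
      rw [← hrP, hrP', hrp, zero_smul]
    have h2 := congrArg (fun w : Fin 3 → UnitaryGroup.LocalRing L v => (↑hu.unit⁻¹ : UnitaryGroup.LocalRing L v) • w) h1
    simp only [smul_smul, hu.val_inv_mul, one_smul, smul_zero] at h2
    exact h2
  have hHv : IsUnit Hv.det := UnitaryGroup.isUnit_det_localForm L 3 H' v hdet
  have hσpj : σ ∘ pj = 0 := by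
    have h1 : (σ ∘ pj) ᵥ* Hv ᵥ* Hv⁻¹ = σ ∘ pj := by
      rw [vecMul_vecMul, Matrix.mul_nonsing_inv _ hHv, vecMul_one]
    rw [← h1, ← hr, hr0, zero_vecMul]
  funext i
  have hi := congrFun hσpj i
  rw [Function.comp_apply, Pi.zero_apply] at hi
  rw [Pi.zero_apply, ← UnitaryGroup.conjLocal_conjLocal (IsCMField.complexConj L) v (complexConj_imagUnit L) (imagUnit_ne_zero L) (pj i)]
  change σ (σ (pj i)) = 0
  rw [hi, map_zero]

end ColumnUnit

/-! ## §2 `κ_v` read on any non-zero column of `P_v` -/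

section KappaColumn

variable (L : Type) [Field L] [NumberField L] [IsCMField L] (v : HeightOneSpectrum (𝓞 ↥(maximalRealSubfield L)))
  (H' : Matrix (Fin 3) (Fin 3) L)
  (a : (UnitaryGroup.cmDatum L 2 (Matrix.of fun i j : Fin 2 => if i.val + j.val + 1 = 2 then (1 : L) else 0)).Local v ×
      (UnitaryGroup.cmDatum L 1 (Matrix.of fun i j : Fin 1 => if i.val + j.val + 1 = 1 then (1 : L) else 0)).Local v)
  (b : (UnitaryGroup.cmDatum L 3 H').Local v)

open scoped Classical in
/-- **`κ_v` READS ON ANY NON-ZERO COLUMN OF `P_v`** (non-split `v`, matching pair, `χ_g(u)` a unit): `κ_v(γ_H, γ′) = +1` if `x_j = p_jᴴ H′_v p_j` is `z σ(z)` for a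
unit `z`, `−1` otherwise — for EVERY `j` with `p_j ≠ 0`, not only the first one read by ★ `finRelPos` (★ `finKappaAt_eq_ite_of_eigenvector` on the eigenvector
`p_j`, ★ `localMatrix_mulVec_finEigenlineProjector_col`). [cite: Rogawski1990, §3.5 Prop. 3.5.2 (c) p. 29; §4.3 p. 43; §14.6 p. 242] [cite: LanglandsShelstad1987, §1] -/
theorem finKappaAt_eq_ite_finColumnFormValue (hv : Subsingleton (UnitaryGroup.PlacesOver L v)) (h : IsLocalNormPair L H' v a b)
    (hu : IsUnit ((finCharpolyTwo L v a).eval (finGammaTwo L v a))) {j : Fin 3} (hj : (fun i => finEigenlineProjector L v H' a b i j) ≠ 0) :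
    finKappaAt L v H' a b =
      if ∃ z : UnitaryGroup.LocalRing L v, IsUnit z ∧
          finColumnFormValue L v H' a b j = z * UnitaryGroup.conjLocal L (IsCMField.complexConj L) v z
      then 1 else -1 := by
  rw [finKappaAt_eq_ite_of_eigenvector L v H' a b hv h hu (localMatrix_mulVec_finEigenlineProjector_col L v H' a b h j) hj]
  rfl

end KappaColumn

end Literature.NumberTheory.Rogawski1990

end
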